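import Summits.BirchSwinnertonDyer.BirchSwinnertonDyer.Theses.GenusKolyvaginAtTwo

/-!
# Route `GenusKolyvaginAtTwo`, LINE 16_T: the glue of the Q4_T split holds (by name)

Item `KolyvaginExactAtTwoPosDiscTOfHalves` (support/glue of the split of the declared residual
Q4_T `KolyvaginExactAtTwoPosDiscT` (stmt-BirchSwinnertonDyer-23240, the `Δ(E) > 0` odd-Tamagawa half of
Kolyvagin exactness at 2) into U⁺_T `ShaCardDvdPowAtTwoPosT` (`#Ш(E/K)[2^∞] ∣ 2^(2M₀)`, annihilation with
regular-Frobenius Kolyvagin primes) and L⁺_T `PowDvdShaCardAtTwoPosT` (`2^(2M₀) ∣ #Ш(E/K)[2^∞]`, structure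
ladder at regular primes); director-bsd g15 2026-08-28T20:03:35Z, critic idea-crit-5 V#142/V#160).
Pen seat `bsd-idea-1` g10; proof re-landed for rev 48 (R9) by LEAD gk2-p1 g20.  THEOREM-ONLY file (no definition, no named fact, no `sorry`): pure logic —
introduce the common frame and apply `Nat.dvd_antisymm`.
BSD is not proved by this; Q4_T is not proved by this (children ⟹ parent only); U⁺_T and L⁺_T stay open.
-/

set_option autoImplicit false
set_option linter.dupNamespace false
set_option linter.unusedVariables false

namespace Summit.BirchSwinnertonDyer.BirchSwinnertonDyer.Theorems.GenusExact

open Summit.BirchSwinnertonDyer.BirchSwinnertonDyer.Theses.GenusKolyvaginAtTwo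

/-- The split glue `U⁺_T → L⁺_T → Q4_T` holds: `#Ш ∣ 2^(2M₀)` and `2^(2M₀) ∣ #Ш` give equality. [folklore] -/
theorem kolyvaginExactAtTwoPosDiscTOfHalves_proof : KolyvaginExactAtTwoPosDiscTOfHalves := by
  -- rev 48 (R9 «Δ>0 cut», LEAD gk2-p1 g20 kit `SketchPos_R9final.kolyvaginExactAtTwoPosDiscTOfHalves''`): the three decls now carry the
  -- antecedent Q2, the odd multiplicative prime and the cut; U⁺_T′ dropped the Kolyvagin binders, L⁺_T′/Q4_T″ kept them (transposition-deep).
  intro hU hL hQ2 W _ _ _ hcm hT v h2v hNv hmult hpos K _ _ hIQ hodd h3 hHe hsq1 hsq2 hρ Dt β ι d₁ hy M₀ hdiv hndiv hw Wd _ _ hWd hSel hTam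
    n d hn hKoly hPn
  exact Nat.dvd_antisymm (hU hQ2 W hcm hT v h2v hNv hmult hpos K hIQ hodd h3 hHe hsq1 hsq2 hρ Dt β ι d₁ hy M₀ hdiv hndiv hw Wd hWd hSel hTam)
    (hL hQ2 W hcm hT v h2v hNv hmult hpos K hIQ hodd h3 hHe hsq1 hsq2 hρ Dt β ι d₁ hy M₀ hdiv hndiv hw Wd hWd hSel hTam n d hn hKoly hPn)

end Summit.BirchSwinnertonDyer.BirchSwinnertonDyer.Theorems.GenusExact
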